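import Summits.QuantumFields.YangMills.Theorems.BalabanLadderUVSeamRecResponseMomentsPinning
import HarnessLib

/-!
# Crux `UVSeamRec` (stmt-QuantumFields-20043), v5(α) stub `stub_responseMomentsOdd6` (RM): NORMAL FORMS of the binder —
# full families suffice, the unit is monotone, and the window clause is eliminable (WLOG `a = uRec`)

Helper file (`--supports stmt-QuantumFields-20043`) of the stub-helper seat `ym-20043-seam-s2` (lane S-A, gen 2).  Three formal
nuisances of the registered binder `ResponseMomentsDefs.ResponseMomentsOdd6SU2` (and of the `hRM` hypothesis of p532025
`TemperedResponse.momentBounds6_of_responseMoments`), removed once and for all so that a prover of the stub may work with the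
leanest statement:

* §1 **`responseMoments_of_univ`** — the binder quantifies over every index set `T ⊆ Fin n`; since a sub-family of an
  admissible family (orientations, radius, separation) is an admissible family, the FULL-FAMILY bound
  `⟨exp(Σ_{i<n} (R⁴/C₁)|kerE_i − p_i|)⟩_{2L+1,β} ≤ exp(B·n)` for all families already gives the bound for every `T` (reindex
  along `T ≃ Fin #T`).  The same for the product currency (`productMoments_of_univ`).
* §2 **`responseMoments_mono_unit`** — the unit enters only the guard `R·a β ≤ ℓ₁`: the response bound at unit `a` gives the
  bound at any unit `a'` with `a β ≤ a' β` for `β ≥ β₂` (thresholds `max β₁ β₂`), and **`responseMoments_unit_smul`** —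
  rescaling the unit by `c > 0` rescales `ℓ₁` to `ℓ₁/c`.
* §3 **`responseMomentsOdd6SU2_iff_atURec`** — hence the window clause `∃ a c, 0 < c ∧ (∀ᶠ β, a β ≤ c·uRec β) ∧ …` of the
  registered binder is ELIMINABLE: `ResponseMomentsOdd6SU2 ↔` the same response-moment statement AT THE UNIT OF RECORD
  `Transport.uRec` itself (no `a`, no `c`).  To prove the stub one may take `a := uRec`; to refute it one must refute the
  body at `uRec` for every `ℓ₁ > 0`.

HONEST FRAMING: bookkeeping for ONE binder of a CONDITIONAL chain; (RM) at `β → ∞` is OPEN; nothing of E0′; not a gap, not Clay.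

References: none beyond the tree (reindexing of finite sums; `Filter.eventually_atTop`).
-/

set_option autoImplicit false

noncomputable section

open MeasureTheory Filter Topology Finset
open Literature.MathematicalPhysics.QuantumFieldTheory (GaugeConfig wilsonMeasure isProbabilityMeasure_wilsonMeasure
  LatticeRep)
open Literature.MathematicalPhysics.QuantumLattice
open Literature.Probability.LatticeModels
open Summit.QuantumFields.YangMills.Cruxes.OSLegsFromFemtoAndGap.DlrCollarTransfer

namespace Summit.QuantumFields.YangMills.Cruxes.UVSeamRec.ResponsePinning

variable {G : Type} [Group G] [TopologicalSpace G] [IsTopologicalGroup G] [CompactSpace G]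
  [MeasurableSpace G] [BorelSpace G] (r : LatticeRep G) (a : ℝ → ℝ)

/-! ## §1 Full families suffice -/

section Univ

/-- A sub-family of a cyclically separated family is cyclically separated (reindexed along `Fin #T ≃ T`). [folklore] -/
theorem separated_comp_equivFin_symm {n L : ℕ} {R : ℕ} {x : Fin n → (Fin 4 → ℤ)} (T : Finset (Fin n))
    (hsep : ∀ i j : Fin n, i ≠ j → ∃ k : Fin 4,
      (2 * (R : ℤ) + 4) ≤ |((((x i k - x j k : ℤ) : ZMod (2 * L + 1))).valMinAbs : ℤ)|) :
    ∀ i' j' : Fin T.card, i' ≠ j' → ∃ k : Fin 4,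
      (2 * (R : ℤ) + 4) ≤ |((((x ((T.equivFin.symm i' : T) : Fin n) k -
        x ((T.equivFin.symm j' : T) : Fin n) k : ℤ) : ZMod (2 * L + 1))).valMinAbs : ℤ)| := by
  intro i' j' hij
  refine hsep _ _ fun h => hij ?_
  exact T.equivFin.symm.injective (Subtype.ext h)

/-- **Full families suffice for (RM).**  If for `β ≥ β₁`, on every odd torus with `4R+8 ≤ L`, `1 ≤ R`, `R·a β ≤ ℓ₁`, for
every admissible family the FULL-FAMILY exponential response moment is `≤ exp(B·n)`, then the same holds for every index set
`T` with `exp(B·#T)` — the `hRM` of p532025 / the body of the registered binder. [folklore] -/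
theorem responseMoments_of_univ {C₁ B β₁ ℓ₁ : ℝ} {p : Fin 4 × Fin 4 → ℝ → ℝ}
    (hU : ∀ β : ℝ, β₁ ≤ β → ∀ (L n : ℕ) (q : Fin n → Fin 4 × Fin 4) (x : Fin n → (Fin 4 → ℤ)) (R : ℕ),
      (∀ i, (q i).1 < (q i).2) → 1 ≤ R → (R : ℝ) * a β ≤ ℓ₁ → 4 * R + 8 ≤ L →
      (∀ i j : Fin n, i ≠ j → ∃ k : Fin 4,
        (2 * (R : ℤ) + 4) ≤ |((((x i k - x j k : ℤ) : ZMod (2 * L + 1))).valMinAbs : ℤ)|) →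
        torusE G r β L (fun U => Real.exp (∑ i, (R : ℝ) ^ 4 / C₁ *
          |kerE G r β (fun k => x i k - (R + 1)) (2 * R + 3) U (plane G r (q i) (x i)) - p (q i) β|)) ≤
          Real.exp (B * n)) :
    ∀ β : ℝ, β₁ ≤ β → ∀ (L n : ℕ) (q : Fin n → Fin 4 × Fin 4) (x : Fin n → (Fin 4 → ℤ)) (R : ℕ),
      (∀ i, (q i).1 < (q i).2) → 1 ≤ R → (R : ℝ) * a β ≤ ℓ₁ → 4 * R + 8 ≤ L →
      (∀ i j : Fin n, i ≠ j → ∃ k : Fin 4,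
        (2 * (R : ℤ) + 4) ≤ |((((x i k - x j k : ℤ) : ZMod (2 * L + 1))).valMinAbs : ℤ)|) →
      ∀ T : Finset (Fin n),
        torusE G r β L (fun U => Real.exp (∑ i ∈ T, (R : ℝ) ^ 4 / C₁ *
          |kerE G r β (fun k => x i k - (R + 1)) (2 * R + 3) U (plane G r (q i) (x i)) - p (q i) β|)) ≤
          Real.exp (B * T.card) := by
  intro β hβ L n q x R hq hR hRa hRL hsep T
  set f : Fin n → LGConfig 4 G → ℝ := fun i U => (R : ℝ) ^ 4 / C₁ *
    |kerE G r β (fun k => x i k - (R + 1)) (2 * R + 3) U (plane G r (q i) (x i)) - p (q i) β| with hf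
  have h : torusE G r β L (fun U => Real.exp (∑ i' : Fin T.card, f ((T.equivFin.symm i' : T) : Fin n) U)) ≤
      Real.exp (B * T.card) :=
    hU β hβ L T.card (fun i' => q ((T.equivFin.symm i' : T) : Fin n))
      (fun i' => x ((T.equivFin.symm i' : T) : Fin n)) R (fun i' => hq _) hR hRa hRL
      (separated_comp_equivFin_symm T hsep)
  have e1 : (fun U : LGConfig 4 G => Real.exp (∑ i ∈ T, f i U)) =
      fun U => Real.exp (∑ i' : Fin T.card, f ((T.equivFin.symm i' : T) : Fin n) U) := by
    funext U
    rw [Equiv.sum_comp T.equivFin.symm (fun t : T => f (t : Fin n) U), Finset.sum_coe_sort T (fun i => f i U)]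
  show torusE G r β L (fun U => Real.exp (∑ i ∈ T, f i U)) ≤ _
  rw [e1]
  exact h

/-- **Full families suffice for (PM)** (the product currency of `…CeilingsProductMoments`) — same reindexing. [folklore] -/
theorem productMoments_of_univ {C₁ B β₁ ℓ₁ : ℝ} {p : Fin 4 × Fin 4 → ℝ → ℝ}
    (hU : ∀ β : ℝ, β₁ ≤ β → ∀ (L n : ℕ) (q : Fin n → Fin 4 × Fin 4) (x : Fin n → (Fin 4 → ℤ)) (R : ℕ),
      (∀ i, (q i).1 < (q i).2) → 1 ≤ R → (R : ℝ) * a β ≤ ℓ₁ → 4 * R + 8 ≤ L →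
      (∀ i j : Fin n, i ≠ j → ∃ k : Fin 4,
        (2 * (R : ℤ) + 4) ≤ |((((x i k - x j k : ℤ) : ZMod (2 * L + 1))).valMinAbs : ℤ)|) →
        torusE G r β L (fun U => ∏ i, (1 + (R : ℝ) ^ 4 / C₁ *
          |kerE G r β (fun k => x i k - (R + 1)) (2 * R + 3) U (plane G r (q i) (x i)) - p (q i) β|)) ≤
          Real.exp (B * n)) :
    ∀ β : ℝ, β₁ ≤ β → ∀ (L n : ℕ) (q : Fin n → Fin 4 × Fin 4) (x : Fin n → (Fin 4 → ℤ)) (R : ℕ),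
      (∀ i, (q i).1 < (q i).2) → 1 ≤ R → (R : ℝ) * a β ≤ ℓ₁ → 4 * R + 8 ≤ L →
      (∀ i j : Fin n, i ≠ j → ∃ k : Fin 4,
        (2 * (R : ℤ) + 4) ≤ |((((x i k - x j k : ℤ) : ZMod (2 * L + 1))).valMinAbs : ℤ)|) →
      ∀ T : Finset (Fin n),
        torusE G r β L (fun U => ∏ i ∈ T, (1 + (R : ℝ) ^ 4 / C₁ *
          |kerE G r β (fun k => x i k - (R + 1)) (2 * R + 3) U (plane G r (q i) (x i)) - p (q i) β|)) ≤
          Real.exp (B * T.card) := by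
  intro β hβ L n q x R hq hR hRa hRL hsep T
  set f : Fin n → LGConfig 4 G → ℝ := fun i U => 1 + (R : ℝ) ^ 4 / C₁ *
    |kerE G r β (fun k => x i k - (R + 1)) (2 * R + 3) U (plane G r (q i) (x i)) - p (q i) β| with hf
  have h : torusE G r β L (fun U => ∏ i' : Fin T.card, f ((T.equivFin.symm i' : T) : Fin n) U) ≤
      Real.exp (B * T.card) :=
    hU β hβ L T.card (fun i' => q ((T.equivFin.symm i' : T) : Fin n))
      (fun i' => x ((T.equivFin.symm i' : T) : Fin n)) R (fun i' => hq _) hR hRa hRL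
      (separated_comp_equivFin_symm T hsep)
  have e1 : (fun U : LGConfig 4 G => ∏ i ∈ T, f i U) =
      fun U => ∏ i' : Fin T.card, f ((T.equivFin.symm i' : T) : Fin n) U := by
    funext U
    rw [Equiv.prod_comp T.equivFin.symm (fun t : T => f (t : Fin n) U), Finset.prod_coe_sort T (fun i => f i U)]
  show torusE G r β L (fun U => ∏ i ∈ T, f i U) ≤ _
  rw [e1]
  exact h

end Univ

/-! ## §2 The unit is monotone; rescaling the unit rescales `ℓ₁` -/

section Unit

/-- **Monotonicity in the unit.**  The unit enters (RM) only through the guard `R·a β ≤ ℓ₁`; if `a β ≤ a' β` for `β ≥ β₂`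
then the response bound at unit `a` (threshold `β₁`) gives the response bound at unit `a'` (threshold `max β₁ β₂`), same
`ℓ₁`, `C₁`, `B`, `p`. [folklore] -/
theorem responseMoments_mono_unit {a a' : ℝ → ℝ} {β₂ : ℝ} (hle : ∀ β, β₂ ≤ β → a β ≤ a' β)
    {C₁ B β₁ ℓ₁ : ℝ} {p : Fin 4 × Fin 4 → ℝ → ℝ}
    (hRM : ∀ β : ℝ, β₁ ≤ β → ∀ (L n : ℕ) (q : Fin n → Fin 4 × Fin 4) (x : Fin n → (Fin 4 → ℤ)) (R : ℕ),
      (∀ i, (q i).1 < (q i).2) → 1 ≤ R → (R : ℝ) * a β ≤ ℓ₁ → 4 * R + 8 ≤ L →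
      (∀ i j : Fin n, i ≠ j → ∃ k : Fin 4,
        (2 * (R : ℤ) + 4) ≤ |((((x i k - x j k : ℤ) : ZMod (2 * L + 1))).valMinAbs : ℤ)|) →
      ∀ T : Finset (Fin n),
        torusE G r β L (fun U => Real.exp (∑ i ∈ T, (R : ℝ) ^ 4 / C₁ *
          |kerE G r β (fun k => x i k - (R + 1)) (2 * R + 3) U (plane G r (q i) (x i)) - p (q i) β|)) ≤
          Real.exp (B * T.card)) :
    ∀ β : ℝ, max β₁ β₂ ≤ β → ∀ (L n : ℕ) (q : Fin n → Fin 4 × Fin 4) (x : Fin n → (Fin 4 → ℤ)) (R : ℕ),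
      (∀ i, (q i).1 < (q i).2) → 1 ≤ R → (R : ℝ) * a' β ≤ ℓ₁ → 4 * R + 8 ≤ L →
      (∀ i j : Fin n, i ≠ j → ∃ k : Fin 4,
        (2 * (R : ℤ) + 4) ≤ |((((x i k - x j k : ℤ) : ZMod (2 * L + 1))).valMinAbs : ℤ)|) →
      ∀ T : Finset (Fin n),
        torusE G r β L (fun U => Real.exp (∑ i ∈ T, (R : ℝ) ^ 4 / C₁ *
          |kerE G r β (fun k => x i k - (R + 1)) (2 * R + 3) U (plane G r (q i) (x i)) - p (q i) β|)) ≤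
          Real.exp (B * T.card) := by
  intro β hβ L n q x R hq hR hRa' hRL hsep T
  have hβ₁ : β₁ ≤ β := (le_max_left _ _).trans hβ
  have hβ₂ : β₂ ≤ β := (le_max_right _ _).trans hβ
  have hRa : (R : ℝ) * a β ≤ ℓ₁ :=
    (mul_le_mul_of_nonneg_left (hle β hβ₂) (Nat.cast_nonneg R)).trans hRa'
  exact hRM β hβ₁ L n q x R hq hR hRa hRL hsep T

/-- **Rescaling the unit.**  The response bound at unit `c·u` with range `ℓ₁` (`c > 0`) is the response bound at unit `u`
with range `ℓ₁/c`. [folklore] -/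
theorem responseMoments_unit_smul {u : ℝ → ℝ} {c : ℝ} (hc : 0 < c) {C₁ B β₁ ℓ₁ : ℝ} {p : Fin 4 × Fin 4 → ℝ → ℝ}
    (hRM : ∀ β : ℝ, β₁ ≤ β → ∀ (L n : ℕ) (q : Fin n → Fin 4 × Fin 4) (x : Fin n → (Fin 4 → ℤ)) (R : ℕ),
      (∀ i, (q i).1 < (q i).2) → 1 ≤ R → (R : ℝ) * (c * u β) ≤ ℓ₁ → 4 * R + 8 ≤ L →
      (∀ i j : Fin n, i ≠ j → ∃ k : Fin 4,
        (2 * (R : ℤ) + 4) ≤ |((((x i k - x j k : ℤ) : ZMod (2 * L + 1))).valMinAbs : ℤ)|) →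
      ∀ T : Finset (Fin n),
        torusE G r β L (fun U => Real.exp (∑ i ∈ T, (R : ℝ) ^ 4 / C₁ *
          |kerE G r β (fun k => x i k - (R + 1)) (2 * R + 3) U (plane G r (q i) (x i)) - p (q i) β|)) ≤
          Real.exp (B * T.card)) :
    ∀ β : ℝ, β₁ ≤ β → ∀ (L n : ℕ) (q : Fin n → Fin 4 × Fin 4) (x : Fin n → (Fin 4 → ℤ)) (R : ℕ),
      (∀ i, (q i).1 < (q i).2) → 1 ≤ R → (R : ℝ) * u β ≤ ℓ₁ / c → 4 * R + 8 ≤ L →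
      (∀ i j : Fin n, i ≠ j → ∃ k : Fin 4,
        (2 * (R : ℤ) + 4) ≤ |((((x i k - x j k : ℤ) : ZMod (2 * L + 1))).valMinAbs : ℤ)|) →
      ∀ T : Finset (Fin n),
        torusE G r β L (fun U => Real.exp (∑ i ∈ T, (R : ℝ) ^ 4 / C₁ *
          |kerE G r β (fun k => x i k - (R + 1)) (2 * R + 3) U (plane G r (q i) (x i)) - p (q i) β|)) ≤
          Real.exp (B * T.card) := by
  intro β hβ L n q x R hq hR hRu hRL hsep T
  refine hRM β hβ L n q x R hq hR ?_ hRL hsep T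
  rw [le_div_iff₀ hc] at hRu
  linarith

end Unit

/-! ## §3 The window clause of the registered binder is eliminable: WLOG `a = uRec` -/

section Named

open Summit.QuantumFields.YangMills.Cruxes.UVSeamRec.ResponseMomentsDefs (ResponseMomentsOdd6SU2)

/-- **`ResponseMomentsOdd6SU2` ⟺ response moments AT THE UNIT OF RECORD.**  The registered binder asks for SOME unit `a`
with `a ≤ c·uRec` eventually (`c > 0`) carrying the response bound with range `ℓ₁`; since the unit only enters the guard
`R·a β ≤ ℓ₁`, this holds iff the response bound holds at the unit `Transport.uRec` itself (with range `ℓ₁/c` and threshold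
`max β₁ β₂`; conversely `a := uRec`, `c := 1`).  Normal form for the prover (take `a := uRec`) and for the disprover
(refute the body at `uRec` for every `ℓ₁ > 0`). [folklore] -/
theorem responseMomentsOdd6SU2_iff_atURec :
    ResponseMomentsOdd6SU2 ↔
      (letI : MeasurableSpace (Matrix.specialUnitaryGroup (Fin 2) ℂ) := borel _
       haveI : BorelSpace (Matrix.specialUnitaryGroup (Fin 2) ℂ) := ⟨rfl⟩
       ∃ (C₁ B β₁ ℓ₁ P₀ : ℝ) (p : Fin 4 × Fin 4 → ℝ → ℝ), 0 < ℓ₁ ∧ 0 < C₁ ∧ (∀ q β, |p q β| ≤ P₀) ∧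
        ∀ β : ℝ, β₁ ≤ β → ∀ (L n : ℕ) (q : Fin n → Fin 4 × Fin 4) (x : Fin n → (Fin 4 → ℤ)) (R : ℕ),
          (∀ i, (q i).1 < (q i).2) → 1 ≤ R → (R : ℝ) * Transport.uRec β ≤ ℓ₁ → 4 * R + 8 ≤ L →
          (∀ i j : Fin n, i ≠ j → ∃ k : Fin 4,
            (2 * (R : ℤ) + 4) ≤ |((((x i k - x j k : ℤ) : ZMod (2 * L + 1))).valMinAbs : ℤ)|) →
          ∀ T : Finset (Fin n),
            torusE (Matrix.specialUnitaryGroup (Fin 2) ℂ) (fundamentalLatticeRep 2) β L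
              (fun U => Real.exp (∑ i ∈ T, (R : ℝ) ^ 4 / C₁ *
                |kerE (Matrix.specialUnitaryGroup (Fin 2) ℂ) (fundamentalLatticeRep 2) β
                  (fun k => x i k - (R + 1)) (2 * R + 3) U
                  (plane (Matrix.specialUnitaryGroup (Fin 2) ℂ) (fundamentalLatticeRep 2) (q i) (x i)) -
                  p (q i) β|)) ≤ Real.exp (B * T.card)) := by
  letI : MeasurableSpace (Matrix.specialUnitaryGroup (Fin 2) ℂ) := borel _
  haveI : BorelSpace (Matrix.specialUnitaryGroup (Fin 2) ℂ) := ⟨rfl⟩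
  constructor
  · rintro ⟨a, c, C₁, B, β₁, ℓ₁, P₀, p, hc, hle, hℓ₁, hC₁, hp, hRM⟩
    obtain ⟨β₂, hβ₂⟩ := Filter.eventually_atTop.1 hle
    refine ⟨C₁, B, max β₁ β₂, ℓ₁ / c, P₀, p, div_pos hℓ₁ hc, hC₁, hp, ?_⟩
    -- unit `a` ⇒ unit `c·uRec` (monotone) ⇒ unit `uRec` with range `ℓ₁/c`
    have h1 := responseMoments_mono_unit (fundamentalLatticeRep 2) (a := a) (a' := fun β => c * Transport.uRec β)
      (β₂ := β₂) hβ₂ hRM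
    exact responseMoments_unit_smul (fundamentalLatticeRep 2) (u := Transport.uRec) hc h1
  · rintro ⟨C₁, B, β₁, ℓ₁, P₀, p, hℓ₁, hC₁, hp, hRM⟩
    refine ⟨Transport.uRec, 1, C₁, B, β₁, ℓ₁, P₀, p, one_pos, Filter.Eventually.of_forall fun β => by simp, hℓ₁,
      hC₁, hp, hRM⟩

end Named

end Summit.QuantumFields.YangMills.Cruxes.UVSeamRec.ResponsePinning

end
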